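import Literature.MathematicalPhysics.QuantumFieldTheory.Balaban1983to89.B9Ineq349MultiLevelTorusP23
import Literature.MathematicalPhysics.QuantumFieldTheory.Balaban1983to89.B9Thm314QGGQInvFlatTransfer
import Literature.MathematicalPhysics.QuantumFieldTheory.Balaban1983to89.B6ScalarFactorsChartV1
import Literature.MathematicalPhysics.QuantumFieldTheory.Balaban1983to89.B8Prop3MultiLevelTorus
import Literature.MathematicalPhysics.QuantumFieldTheory.Balaban1983to89.B5Positivity172Lattice
import Literature.MathematicalPhysics.QuantumFieldTheory.Balaban1983to89.B6CubeWindowV1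

/-!
# `Balaban1983to89.B9Thm314GFlatV1Kernel` — [B9] THEOREM 3.14 (pp. 426–427, (3.154)) AT `U = 1` FOR THE GENUINE `k`-LEVEL
`G = Δ_a⁻¹` ((2.19)/(2.22) of [4]) ON THE V1 TORUS, FILE 1 (KERNEL): the second resolvent identity
`G[Ω] − G[Ω′] = G[Ω](Δ_a[Ω′] − Δ_a[Ω])G[Ω′]` for two nested families `{Ω_j}`, `{Ω′_j}` on one torus `T_η`, the splitting of the
perturbation into the `∂P∂*` LETTER `V_P = ∂((I − R[Ω]) − (I − R[Ω′]))∂*` and the `Q*aQ` LETTER `V_Q = Q*aQ[Ω′] − Q*aQ[Ω]`, the chart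
kernel of `V_P` in p21's torus matrices `∂_μ·P·∂_νᵀ` with its one-family (3.49)₄ bound (r05) and — after the cancellation of the common
top index bonds — the localisation of every surviving term of `V_Q` in `Ωᶜ` (no existing module is touched; no fact is minted)

FRAMING (verbatim cell line):
statement-level skeleton of published theorems with citation tags; proofs where landed; nothing here is a claim about the Yang–Mills mass gap

Sources under audit (cell pub-balaban / lit-balaban): T. Bałaban, *Propagators for lattice gauge theories in a background field*,
Commun. Math. Phys. **99** (1985) 389–434 [`Balaban1985BackgroundPropagators`, "B9"], pp. 426–427 [PDF 38–39] (Theorem 3.14, (3.154)),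
p. 399 [PDF 11] ((3.49)) — held text `paper:balaban1985-cmp99-background-propagators` p0038/p0039 read this generation; T. Bałaban,
*Propagators and renormalization transformations for lattice gauge theories. II*, Commun. Math. Phys. **96** (1984) 223–250
[`Balaban1984PropagatorsII`, "[4]"], (2.16)–(2.22) pp. 225–226, Prop. 2.6 (2.136) p. 247, (2.88) p. 238 — held text
`paper:balaban1984-cmp96-propagators-rt-ii` p0003/p0004/p0016/p0025; T. Bałaban, *Propagators … I*, Commun. Math. Phys. **95** (1984)
17–40 [`Balaban1984PropagatorsI`], (1.11) p. 19, (1.18) p. 20 (the iterated bond average `Q_j`) through the tree's verbatim quotations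
(`LatticeFieldCalculus`, `B8Prop3MultiLevelTorus`).  Unit `lit-balaban-p21` (Phase-2 proof seat p21 gen 20, HOME
`run/shared/lean/pub/lit-balaban/`, free-target protocol G.5-34(d), TAKING 2026-08-23T16:59Z; B9 fold owner r06, referee ref-4).

## WHAT IS PRINTED (quotations AS PRINTED)

B9 pp. 426–427 (scan p038/p039): «We construct operators for both sequences and we define Ω = Ω_k ∩ Ω′_k. Let us take localizations
determined by points y, y′ ∈ Ω^{(k)} (i.e. these are cubes Δ(y), Δ(y′) in the case of operators G′, G, G₁, 𝔊, …). We have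
**Theorem 3.14.** If we take a pair of operators constructed for the two sequences {Ω_j}, {Ω′_j}, then their difference satisfies all the
inequalities characteristic for operators of the considered type, with the additional factor exp(−δ₀d(y, y′, Ω)),
d(y, y′, Ω) = inf_{y₁∈Ωᶜ∩T^{(k)}} (|y − y₁| + |y₁ − y′|) (3.154) on the right-hand sides. This theorem can be proved in exactly the same
way as the corresponding property in the theorem of [2]. We take random walk expansions for both operators, and in the difference all
terms for walks with localizations contained in Ω are cancelled. Remaining terms correspond to walks of the general type (3.107), for
which at least one localization X_i intersects Ωᶜ.»  [4] p. 226 (scan p004): «Δ_a = ∂*∂ + ∂R∂* + Q*aQ = Δ − ∂P∂* + Q*aQ, (2.19) … hence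
the first equation implies A = G∂Rλ + GQ*ω, (2.22) where G = Δ_a⁻¹.»; p. 247 (scan p025): «Proposition 2.6. There exists a positive
constant δ₃ depending on d and L only, such that |(GJ)(x)|, |(∇GJ)(x)|, |(G∇*J)(x)|, |(ΔGJ)(x)| ≦ O(1)[(L^jη)², L^jη, L^jη, 1]
e^{−δ₃d(y,y′)}|J| (2.136) for x ∈ Δ(y), y ∈ Λ_j, supp J ⊂ Δ(y′), with the constant O(1) depending on d and L only».

## WHAT THIS FILE CERTIFIES (kernel-checked; V1 torus `B6GlobalChartV1.PV`, families `domT hN D hk` of p21's `TDomains`)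

* §1 **`GE_sub_GE`** — the second resolvent identity `G − G′ = G(Δ_a[Ω′] − Δ_a[Ω])G′` for `B6SectAVectorModelV1.GE` of two `Domains` on one
  `Params` (from `GΔ_a = 1 = Δ_aG`); **`deltaAE_sub_deltaAE`** — `Δ_a[Ω′] − Δ_a[Ω] = ∂((I−R) − (I−R′))∂* + (Q*aQ′ − Q*aQ)` ((2.19); `∂*∂` cancels).
* §2 the letters on bond FUNCTIONS: **`VP`** `:= ∂_c ∘ chartOp(pM[Ω] − pM[Ω′]) ∘ ∂_c*` and **`VQ`** `:= onFun(Q*aQ[Ω′]) − onFun(Q*aQ[Ω])` (defs with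
  bodies), `onFun_oneSubRE_eq_chartOp` (Sect. A's `I − R = chartOp pM`, from p21 gen 19's `RE_eq_rM_chart` as in p22's `onFun_oneSubRE_eq`),
  **`onFun_GE_sub`** (`onFun G[Ω] − onFun G[Ω′] = onFun G[Ω] ∘ (V_P + V_Q) ∘ onFun G[Ω′]`), **`VP_single_apply`** (the chart kernel:
  `(V_P e_v)(f) = c_f²·[dPd[Ω] − dPd[Ω′]]_{μν}(x̂, x̂′)`, p21's `B6Ineq288MultiLevelTorus.dPd = ∂_μ·pM·∂_νᵀ`).
* §3 the dictionary `QM/QsM/GiM` ↔ `QB/QsB/GinvT`, **`pProjMLT_printed_apply`** (r05's `pProjMLT D a (GinvT D a)` at `a = aPrinted ℓ 1` IS `pM`),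
  **`member4_eq_dPd`** (the (3.49)₄-member expression `∂_μ·P·(∂_νᵀe_{x′})` is the entry of `dPd`).
* §4 **`dPd_le`** — the one-family (3.49)₄ at `U = 1` for `dPd` (r05's `ineq349_multiLevelTorus_P23` at the printed weights, windows
  `B6Prop22KLevelCensus.KIdx.aPrinted_windows`).
* §5 the `Q*aQ` letter: `IsCT` (common top index bonds), `qk` (the weight `q_i(f) = Q_j(c,f)`), `qk_le` (column mass `≤ (L^{d+1})^{−j}`, r05),
  `bondAvgIter_eq_sum_qk`/`sum_qk`/`abs_bondAvgIter_le_sum_qk` (`(Qh)_i = Σ_f q_i(f)h(f)`, row mass `1`), `trunc`/`trunc'` (the truncated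
  weighted averages), **`sum_CT_eq`** (the common top parts agree when the weights agree), **`VQ_apply_eq`** (`(V_Qh)(f) = (Q′*v′)(f) − (Q*v)(f)`),
  **`witness_of_not_isCT`/`witness_of_not_isCT'`** (a surviving index bond charges only fine bonds whose `k`-lattice point is in `Ωᶜ ∩ T^{(k)}`:
  coverage `lev ≤ j` (r05) for `j < k`; for `j = k`, `c ∉ st(Ω′_k)` and the block locality of `Q_k` (r05) put the `k`-block of `f₋` outside `Ω′_k`),
  `w_le_of_band` (the weight band (2.16) as used).
  Inputs BY NAME, restating nothing: `B6SectAVectorModelV1` (`GE`, `deltaAE`), `B6SectAOperatorsV1`, p22's `B6ScalarFactorsChartV1` (`chartOp`,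
  `dE_chartOp_apply`, `chartOp_dsE_apply`, `onFun_eq_chartOp`), `B6Dg288ChartV1.RE_eq_rM_chart`, `B6Ineq288MultiLevelTorus` (`pM`, `dPd`,
  `one_sub_rM`), r05's `B9Ineq349MultiLevelTorusP23.ineq349_multiLevelTorus_P23` and `B8Prop3MultiLevelTorus` (`QsE_apply_eq_sum`,
  `sum_bondAvgIter_single`, `bondAvgIter_single_nonneg`, `iterBlockOf_of_bondAvgIter_single_ne_zero`, `lev_le_of_bondAvgIter_single_ne_zero`),
  r03's `B6GlobalChartV1` (`domT`, `iterBlockOf_mem_domT_iff`, `blkV1`), `B6CubeWindowV1.GlobalBand`, `B5Positivity172Lattice.bondAvgIter_dirConst`,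
  gen 18's `B9Thm314GpFlatTorusGeometry` (`OmegaC`, `dOmega`).

## HONEST SCOPE

* `U = 1` only; the V1 torus lineage (`PV`, `domT`, p21's `TDomains`: `Ω₁ = T_η`, levels `1 … k`, lattice units with the explicit fine factor
  `c_f`).  This file proves identities, the kernel dictionary and the LOCALISATION of the perturbation only; the estimates of Theorem 3.14 for `G`
  ((2.136)₁ member with the factor (3.154)) are FILES 2–3 (`B9Thm314GFlatV1Transfer`, `B9Thm314GFlatV1MultiLevelTorus`).
* ROUTE (declared; `U = 1` admits it, as in gens 18–19 for `G′`, `(Q′G′²Q′*)⁻¹`, `P`): the second resolvent identity in place of print's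
  walk-expansion cancellation; the cancellation «all terms … contained in Ω are cancelled» is the equality `sum_CT_eq` of the common top parts of
  `Q*aQ` (weights agreeing on the common top index bonds — print's weights `a(L^jη)^{d−2}` are level-determined) and the vanishing of `V_P` between
  equal projections is replaced by gen 19's two-family (3.49)₄ difference (FILE 3).
* Nothing is inferred from the manuscript: every step is kernel-checked; the quoted sentences locate the statements.
-/

noncomputable section

open scoped BigOperators Matrix
open Finset

namespace Literature.MathematicalPhysics.QuantumFieldTheory.Balaban1983to89.B9Thm314GFlatV1Kernel

open B4Reflection242 (boxDom blk)
open B6MultiLevelBoxOperator (N0 aPrinted)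
open B6MultiLevelTorusOperator (TDomains)
open B6Geom246MultiLevelBox (bset blkOf)
open B6Geom246MultiLevelTorus (geomT)
open B6RandomWalk (HasMajorant BlockSupp)
open B6Ineq2133TwoScaleV1 (onFun onFun_apply)
open B6SectAOperatorsV1 (ScalarSpace dE dsE dcE dcsE QE QsE aE RE BondIdx BondIdxSpace)
open B6SectAVectorModelV1 (GE deltaAE deltaAE_def GE_comp_deltaAE deltaAE_comp_GE)
open BalabanImbrieJaffe1984to88.BIJ85AxialPropagator411 (BondSpace)
open B6GlobalChartV1 (PV toBox toBox_injective boxEquiv boxEquiv_apply blkV1 domT)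
open B6ScalarChartV1 (boxEquiv_symm_toBox toBox_boxEquiv_symm)
open B6ScalarFactorsChartV1 (chartOp chartOp_apply chartOp_mul chartOp_sub onFun_eq_chartOp dE_chartOp_apply chartOp_dsE_apply comp)
open B6Dg288ChartV1 (RE_eq_rM_chart)
open B6Ineq288MultiLevelTorus (GT QsM QM GiM pM dPd rM one_sub_rM)
open B6Ineq268MultiLevelBox (W W_pos QB QsB QB_apply QsB_apply)
open B6Prop23MultiLevelTorus (GinvT)
open B6Prop23Chain (mat apply_eq_sum_mat)
open B6Prop22DerivMultiLevelTorus (dT)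
open B9Ineq349MultiLevelTorus (pProjMLT pProjMLT_apply)

variable {d ℓ : ℕ} {m K : ℕ} {hd : 1 ≤ d + 1} {hL : Odd (ℓ + 1) ∧ 1 < ℓ + 1}
variable {Mh k R : ℕ} {P' : Fin (d + 1) → ℕ}

/-! ## §1  The second resolvent identity `G[Ω] − G[Ω′] = G[Ω](Δ_a[Ω′] − Δ_a[Ω])G[Ω′]` and the two letters of the perturbation -/

section Resolvent

variable {P₀ : Params} (Dm Dm' : B6SectADomainsV1.Domains P₀)

/-- **THE SECOND RESOLVENT IDENTITY FOR TWO FAMILIES ON ONE TORUS** (operator level): for `G = Δ_a⁻¹` of the family `{Ω_j}` and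
`G′ := Δ_a[Ω′]⁻¹` of `{Ω′_j}` (both on the bond functions of `T_η`), `G − G′ = G(Δ_a[Ω′] − Δ_a[Ω])G′`.
[cite: Balaban1984PropagatorsII, (2.22) p.226 («G = Δ_a^{−1}»); Balaban1985BackgroundPropagators, Thm 3.14 p.426–427, dictionary] -/
theorem GE_sub_GE {c : ℝ} (hc : c ≠ 0) {w : BondIdx Dm → ℝ} (hw : ∀ i, 0 < w i) {w' : BondIdx Dm' → ℝ} (hw' : ∀ i, 0 < w' i) :
    GE Dm hc hw - GE Dm' hc hw' = GE Dm hc hw ∘ₗ (deltaAE Dm' c w' - deltaAE Dm c w) ∘ₗ GE Dm' hc hw' := by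
  rw [LinearMap.sub_comp, LinearMap.comp_sub, deltaAE_comp_GE, LinearMap.comp_id, ← LinearMap.comp_assoc, GE_comp_deltaAE,
    LinearMap.id_comp]

/-- **THE PERTURBATION SPLITS INTO THE `∂P∂*` LETTER AND THE `Q*aQ` LETTER**: with `Δ_a = ∂*∂ + ∂R∂* + Q*aQ` (2.19) and `R = I − P`,
`Δ_a[Ω′] − Δ_a[Ω] = ∂((I − R[Ω]) − (I − R[Ω′]))∂* + (Q*aQ[Ω′] − Q*aQ[Ω])` — the `∂*∂` part is family-independent.
[cite: Balaban1984PropagatorsII, (2.19) p.226, (2.17)–(2.18) p.225] -/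
theorem deltaAE_sub_deltaAE (c : ℝ) (w : BondIdx Dm → ℝ) (w' : BondIdx Dm' → ℝ) :
    deltaAE Dm' c w' - deltaAE Dm c w
      = dE c ∘ₗ ((LinearMap.id - RE Dm c) - (LinearMap.id - RE Dm' c)) ∘ₗ dsE c
        + (QsE Dm' ∘ₗ aE Dm' w' ∘ₗ QE Dm' - QsE Dm ∘ₗ aE Dm w ∘ₗ QE Dm) := by
  rw [deltaAE_def, deltaAE_def]
  have e : (LinearMap.id - RE Dm c) - (LinearMap.id - RE Dm' c) = RE Dm' c - RE Dm c := by abel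
  rw [e, LinearMap.sub_comp, LinearMap.comp_sub]
  abel

end Resolvent

/-! ## §2  The letters on the bond FUNCTIONS of the V1 torus (`onFun`), and the chart kernel of the `∂P∂*` letter -/

section Letters

variable (hN : ∀ μ, N0 ℓ Mh k P' μ = (PV d ℓ m K hd hL).sitesPerDir 0) (D D' : TDomains d ℓ Mh k P' R) (hk : k ≤ m + K)

/-- `onFun` is multiplicative. [folklore] -/
private theorem onFun_comp' {ι κ τ : Type*} (f : EuclideanSpace ℝ κ →ₗ[ℝ] EuclideanSpace ℝ ι) (g : EuclideanSpace ℝ τ →ₗ[ℝ] EuclideanSpace ℝ κ) :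
    onFun (f ∘ₗ g) = onFun f ∘ₗ onFun g := rfl

/-- `onFun` is additive/subtractive. [folklore] -/
private theorem onFun_sub' {ι κ : Type*} (f g : EuclideanSpace ℝ κ →ₗ[ℝ] EuclideanSpace ℝ ι) : onFun (f - g) = onFun f - onFun g := rfl

/-- `onFun` of a sum. [folklore] -/
private theorem onFun_add' {ι κ : Type*} (f g : EuclideanSpace ℝ κ →ₗ[ℝ] EuclideanSpace ℝ ι) : onFun (f + g) = onFun f + onFun g := rfl

/-- **THE `∂P∂*` LETTER ON THE V1 BOND FUNCTIONS**: `V_P := ∂_c ∘ (P̂[Ω] − P̂[Ω′]) ∘ ∂_c*` with `P̂ = chartOp pM` p21's torus matrix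
`P = G′Q′*(Q′G′²Q′*)⁻¹Q′G′` (2.17) of each family read through the chart. [cite: Balaban1984PropagatorsII, (2.17)–(2.19) pp.225–226] -/
def VP (cf : ℝ) : Module.End ℝ (PBond (PV d ℓ m K hd hL) 0 → ℝ) :=
  onFun (dE cf) ∘ₗ chartOp hN (pM D - pM D') ∘ₗ onFun (dsE (P := PV d ℓ m K hd hL) cf)

/-- **THE `Q*aQ` LETTER ON THE V1 BOND FUNCTIONS**: `V_Q := Q*aQ[Ω′] − Q*aQ[Ω]`. [cite: Balaban1984PropagatorsII, (2.16) p.225, (2.19)–(2.20) p.226] -/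
def VQ (w : BondIdx (domT hN D hk) → ℝ) (w' : BondIdx (domT hN D' hk) → ℝ) :
    Module.End ℝ (PBond (PV d ℓ m K hd hL) 0 → ℝ) :=
  onFun (QsE (domT hN D' hk) ∘ₗ aE (domT hN D' hk) w' ∘ₗ QE (domT hN D' hk))
    - onFun (QsE (domT hN D hk) ∘ₗ aE (domT hN D hk) w ∘ₗ QE (domT hN D hk))

/-- **`I − R = P̂` ON THE V1 SITE FUNCTIONS** (gen 19's `RE_eq_rM_chart` + `1 − rM = pM`): Sect. A's orthogonal projection complemented IS
p21's charted torus matrix `pM`. [cite: Balaban1984PropagatorsII, (2.17) p.225 («Rf = … (I − G′Q′*(Q′G′²Q′*)⁻¹Q′G′)f»)] -/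
theorem onFun_oneSubRE_eq_chartOp (hℓ : 1 ≤ ℓ) (hMh : 1 ≤ Mh) (hP : ∀ μ, 1 ≤ P' μ) {c : ℝ} (hc : c ≠ 0) :
    onFun (LinearMap.id - RE (domT hN D hk) c) = chartOp hN (pM D) := by
  refine onFun_eq_chartOp hN fun f x => ?_
  rw [← one_sub_rM, Matrix.sub_mulVec, Matrix.one_mulVec, Pi.sub_apply, LinearMap.sub_apply, LinearMap.id_apply, PiLp.sub_apply,
    RE_eq_rM_chart hN D hk hℓ hMh hP hc f x, boxEquiv_symm_toBox]

/-- **THE RESOLVENT IDENTITY ON THE BOND FUNCTIONS WITH THE TWO LETTERS**: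
`G[Ω] − G[Ω′] = G[Ω]·(V_P + V_Q)·G[Ω′]` as endomorphisms of the bond functions of `T_η`.
[cite: Balaban1984PropagatorsII, (2.19)–(2.22) p.226; Balaban1985BackgroundPropagators, Thm 3.14 p.426–427, dictionary] -/
theorem onFun_GE_sub (hℓ : 1 ≤ ℓ) (hMh : 1 ≤ Mh) (hP : ∀ μ, 1 ≤ P' μ) {cf : ℝ} (hcf : cf ≠ 0)
    {w : BondIdx (domT hN D hk) → ℝ} (hw : ∀ i, 0 < w i) {w' : BondIdx (domT hN D' hk) → ℝ} (hw' : ∀ i, 0 < w' i) :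
    onFun (GE (domT hN D hk) hcf hw) - onFun (GE (domT hN D' hk) hcf hw')
      = onFun (GE (domT hN D hk) hcf hw) ∘ₗ (VP hN D D' cf + VQ hN D D' hk w w') ∘ₗ onFun (GE (domT hN D' hk) hcf hw') := by
  rw [← onFun_sub', GE_sub_GE _ _ hcf hw hw', onFun_comp', onFun_comp', deltaAE_sub_deltaAE, onFun_add', onFun_comp', onFun_comp',
    onFun_sub' (LinearMap.id - RE _ cf), onFun_oneSubRE_eq_chartOp hN D hk hℓ hMh hP hcf,
    onFun_oneSubRE_eq_chartOp hN D' hk hℓ hMh hP hcf, ← chartOp_sub]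
  rfl


/-- the components of a unit bond function read on the box: the `ν`-component of `e_v` is `e_{toBox v₋}` if `ν` is the direction of `v`, else `0`.
[cite: Balaban1984PropagatorsII, (2.8) p.224, dictionary] -/
theorem comp_single (v : PBond (PV d ℓ m K hd hL) 0) (ν : Fin (d + 1)) :
    comp hN (Pi.single v (1 : ℝ)) ν = if ν = v.dir then Pi.single (toBox hN v.src) (1 : ℝ) else 0 := by
  classical
  funext z
  unfold comp
  by_cases hν : ν = v.dir
  · rw [if_pos hν]
    by_cases hz : z = toBox hN v.src
    · subst hz
      rw [boxEquiv_symm_toBox, Pi.single_eq_same]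
      have : (⟨v.src, ν⟩ : PBond (PV d ℓ m K hd hL) 0) = v := by cases v; simp only at hν; rw [hν]
      rw [this, Pi.single_eq_same]
    · rw [Pi.single_eq_of_ne hz]
      have hne : (⟨(boxEquiv hN).symm z, ν⟩ : PBond (PV d ℓ m K hd hL) 0) ≠ v := by
        intro h
        apply hz
        have hs : (boxEquiv hN).symm z = v.src := by rw [← h]
        rw [← hs, ← boxEquiv_apply, Equiv.apply_symm_apply]
      rw [Pi.single_eq_of_ne hne]
  · rw [if_neg hν]
    have hne : (⟨(boxEquiv hN).symm z, ν⟩ : PBond (PV d ℓ m K hd hL) 0) ≠ v := by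
      intro h; apply hν; rw [← h]
    rw [Pi.single_eq_of_ne hne]; rfl

/-- a matrix entry as the value of `M·e_{x′}`. [folklore] -/
private theorem mulVec_single_one_apply {n : Type*} [Fintype n] [DecidableEq n] (M : Matrix n n ℝ) (i j : n) :
    (M *ᵥ Pi.single j (1 : ℝ)) i = M i j := by
  rw [Matrix.mulVec, dotProduct_single, mul_one]

/-- **THE CHART KERNEL OF THE `∂P∂*` LETTER**: for fine bonds `f = ⟨x, μ⟩`, `v = ⟨x′, ν⟩` of `T_η`,
`(V_P e_v)(f) = c_f²·[(∂_μP[Ω]∂_ν*)(x, x′) − (∂_μP[Ω′]∂_ν*)(x, x′)]` with p21's torus matrices `dPd = ∂_μ·pM·∂_νᵀ` ((2.88) shape)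
at the chart points. [cite: Balaban1984PropagatorsII, (2.88) p.238, (2.18)–(2.19) pp.225–226, dictionary] -/
theorem VP_single_apply (cf : ℝ) (f v : PBond (PV d ℓ m K hd hL) 0) :
    VP hN D D' cf (Pi.single v (1 : ℝ)) f
      = cf ^ 2 * (dPd D f.dir v.dir (toBox hN f.src) (toBox hN v.src) - dPd D' f.dir v.dir (toBox hN f.src) (toBox hN v.src)) := by
  classical
  have h1 : VP hN D D' cf (Pi.single v (1 : ℝ)) f
      = (onFun (dE cf) ∘ₗ chartOp hN (pM D - pM D')) (onFun (dsE (P := PV d ℓ m K hd hL) cf) (Pi.single v 1)) f := rfl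
  have h2 : ((dT (N0 ℓ Mh k P') f.dir * (pM D - pM D')) *ᵥ fun z => (onFun (dsE (P := PV d ℓ m K hd hL) cf) (Pi.single v 1))
        ((boxEquiv hN).symm z)) (toBox hN f.src)
      = (chartOp hN (dT (N0 ℓ Mh k P') f.dir * (pM D - pM D')) ∘ₗ onFun (dsE cf)) (Pi.single v (1 : ℝ)) f.src := rfl
  rw [h1, dE_chartOp_apply, h2, chartOp_dsE_apply]
  simp_rw [comp_single hN v]
  rw [Finset.sum_eq_single v.dir]
  · rw [if_pos rfl, mulVec_single_one_apply]
    unfold dPd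
    rw [Matrix.mul_sub, Matrix.sub_mul, Matrix.sub_apply]
    ring
  · intro ν _ hν; rw [if_neg hν, Matrix.mulVec_zero]; rfl
  · intro h; exact absurd (Finset.mem_univ _) h

end Letters

/-! ## §3  The `∂P∂*` letter in p21's torus language: `P = pM` at the printed weights; the two-family (3.49)₄ difference (gen 19) and the one-family (3.49)₄ -/

section Dictionary

variable {ℓ Mh k R : ℕ} {P : Fin (d + 1) → ℕ} (D : TDomains d ℓ Mh k P R)

/-- `Q′` as the matrix `QM`. [cite: Balaban1984PropagatorsII, (2.14) p.225, dictionary] -/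
theorem QM_mulVec (g : ↥(boxDom (N0 ℓ Mh k P)) → ℝ) : QM D *ᵥ g = QB D.toDomains g := by
  classical
  funext y
  rw [QB_apply, Matrix.mulVec, dotProduct, Finset.sum_filter]
  rw [Finset.mul_sum]
  refine Finset.sum_congr rfl fun x _ => ?_
  unfold QM
  split_ifs <;> simp

/-- `Q′*` as the matrix `QsM`. [cite: Balaban1984PropagatorsII, (2.16) p.225, dictionary] -/
theorem QsM_mulVec (ω : ↥(bset D.toDomains) → ℝ) : QsM D *ᵥ ω = QsB D.toDomains ω := by
  classical
  funext x
  rw [QsB_apply, Matrix.mulVec, dotProduct]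
  unfold QsM
  simp only [ite_mul, one_mul, zero_mul]
  rw [Finset.sum_ite_eq]
  simp

/-- `(Q′G′²Q′*)⁻¹` as the matrix `GiM`. [cite: Balaban1984PropagatorsII, (2.86) p.238, dictionary] -/
theorem GiM_mulVec (ω : ↥(bset D.toDomains) → ℝ) : GiM D *ᵥ ω = GinvT D (aPrinted ℓ 1) ω := by
  funext y
  rw [apply_eq_sum_mat, Matrix.mulVec, dotProduct]
  rfl

/-- **r05's `P = G′Q′*(Q′G′²Q′*)⁻¹Q′G′` AT THE PRINTED WEIGHTS IS p21's MATRIX `pM`**: `pProjMLT D a_printed (GinvT D a_printed) f = pM·f`.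
[cite: Balaban1985BackgroundPropagators, (3.25) p.394; Balaban1984PropagatorsII, (2.17) p.225] -/
theorem pProjMLT_printed_apply (f : ↥(boxDom (N0 ℓ Mh k P)) → ℝ) :
    pProjMLT D (aPrinted ℓ 1) (GinvT D (aPrinted ℓ 1)) f = pM D *ᵥ f := by
  rw [pProjMLT_apply]
  unfold pM
  rw [← Matrix.mulVec_mulVec, ← Matrix.mulVec_mulVec, ← Matrix.mulVec_mulVec, ← Matrix.mulVec_mulVec, QM_mulVec, GiM_mulVec,
    QsM_mulVec]

/-- **THE (3.49)₄-MEMBER EXPRESSION IS THE ENTRY OF `dPd`**: `(∂_μ·P·(∂_νᵀe_{x′}))(x) = dPd μ ν x x′`.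
[cite: Balaban1985BackgroundPropagators, (3.49) p.399; Balaban1984PropagatorsII, (2.88) p.238] -/
theorem member4_eq_dPd (μ ν : Fin (d + 1)) (x x' : ↥(boxDom (N0 ℓ Mh k P))) :
    (dT (N0 ℓ Mh k P) μ *ᵥ pProjMLT D (aPrinted ℓ 1) (GinvT D (aPrinted ℓ 1)) ((dT (N0 ℓ Mh k P) ν)ᵀ *ᵥ Pi.single x' 1)) x
      = dPd D μ ν x x' := by
  classical
  rw [pProjMLT_printed_apply, Matrix.mulVec_mulVec, Matrix.mulVec_mulVec, mulVec_single_one_apply]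
  rfl

end Dictionary

/-! ## §4  The sizes of the `∂P∂*` letter: the one-family (3.49)₄ at U = 1 (r05) and the two-family difference (gen 19), at the printed weights -/

section Sizes

open B6Ineq243TwoLevelBox (aNext)
open B9Thm314GpFlatTorusGeometry (dOmega)

/-- **(3.49)₄ AT U = 1 FOR THE GENUINE k-LEVEL TORUS `P`, AS A BOUND OF THE MATRIX `dPd`** (r05's `ineq349_multiLevelTorus_P23` member 4 at the
printed weights `a_j = aPrinted ℓ 1 j`, windows `KIdx.aPrinted_windows`): `∃ ρ B M₀ N₀ > 0`, for `M_h ≥ 3`, `M₀ ≤ L·M_h`, `R ≥ 2L`, `R·L·M_h ≥ N₀ + 1`,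
`P_μ ≥ 4`, every torus family `D`: `|(∂_μP∂_ν*)(x, x′)| ≤ B·(L^{j(x)})⁻²·W(y(x′))⁻¹·e^{−ρ d(y(x), y(x′))}`.
[cite: Balaban1985BackgroundPropagators, (3.49) p.399; Balaban1984PropagatorsII, (2.88) p.238, Prop. 2.3 (2.87) p.238] -/
theorem dPd_le (d ℓ : ℕ) (hℓ : 1 ≤ ℓ) :
    ∃ ρ B M₀ : ℝ, ∃ N₀ : ℕ, 0 < ρ ∧ 0 < B ∧ 0 < M₀ ∧ 0 < N₀ ∧
      ∀ (k Mh R : ℕ), 3 ≤ Mh → M₀ ≤ ((ℓ : ℝ) + 1) * Mh → 2 * (ℓ + 1) ≤ R → N₀ + 1 ≤ R * ((ℓ + 1) * Mh) →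
      ∀ (P : Fin (d + 1) → ℕ) (_hP4 : ∀ μ, 4 ≤ P μ) (D : TDomains d ℓ Mh k P R) (μ ν : Fin (d + 1)) (x x' : ↥(boxDom (N0 ℓ Mh k P))),
        |dPd D μ ν x x'| ≤ B * ((((ℓ : ℝ) + 1) ^ D.lev x.1) ^ 2)⁻¹ * (W D.toDomains (blkOf D.toDomains x'))⁻¹ *
          Real.exp (-(ρ * (geomT D).dist (blkOf D.toDomains x) (blkOf D.toDomains x'))) := by
  set amin : ℝ := 1 - ((((ℓ : ℝ) + 1)) ^ 2)⁻¹ with hamin_def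
  have hL2 : (1 : ℝ) < (((ℓ : ℝ) + 1)) ^ 2 := by
    have : (2 : ℝ) ≤ (ℓ : ℝ) + 1 := by
      have : (1 : ℝ) ≤ ℓ := by exact_mod_cast hℓ
      linarith
    nlinarith
  have hamin : 0 < amin := by rw [hamin_def, sub_pos]; exact inv_lt_one_of_one_lt₀ hL2
  obtain ⟨hwin, hrec⟩ := B6Prop22KLevelCensus.KIdx.aPrinted_windows hℓ
  obtain ⟨ρ, B, M₀, N₀, hρ, hB, hM₀, hN₀, h⟩ :=
    B9Ineq349MultiLevelTorusP23.ineq349_multiLevelTorus_P23 d ℓ hℓ amin 1 1 1 hamin one_pos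
  refine ⟨ρ, B, M₀, N₀, hρ, hB, hM₀, hN₀, ?_⟩
  intro k Mh R hMh hM hR hRM P hP4 D μ ν x x'
  have hP : ∀ μ, 1 ≤ P μ := fun μ => le_trans (by norm_num) (hP4 μ)
  obtain ⟨-, -, -, -, hx⟩ := h k Mh R hMh hM hR hRM P hP hP4 D (aPrinted ℓ 1) (fun _ => 1) hwin (fun i _ => ⟨le_rfl, le_rfl⟩) hrec
  obtain ⟨-, -, -, h4⟩ := hx x x'
  rw [← member4_eq_dPd]
  exact h4 μ ν

end Sizes

/-! ## §5  The `Q*aQ` letter: cancellation on the common top index bonds; the survivors are localised in `Ωᶜ`; sizes -/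

section QLetter

open LatticeFieldCalculus (bondAvgIter)
open B5Eq118OneStroke (iterBlockOf)
open B9Thm314GpFlatTorusGeometry (OmegaC blk_mem_OmegaC)
open B6GlobalChartV1 (iterBlockOf_mem_domT_iff)
open B6CubeWindowV1 (GlobalBand)
open B8Prop3MultiLevelTorus (QsE_apply_eq_sum sum_bondAvgIter_single bondAvgIter_single_nonneg iterBlockOf_of_bondAvgIter_single_ne_zero
  lev_le_of_bondAvgIter_single_ne_zero)

variable (hN : ∀ μ, N0 ℓ Mh k P' μ = (PV d ℓ m K hd hL).sitesPerDir 0) (D D' : TDomains d ℓ Mh k P' R) (hk : k ≤ m + K)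

/-- **THE COMMON TOP INDEX BONDS**: a pair `(j, c)` is an index bond of BOTH families AT THE TOP LEVEL — `j = k`, `c ∈ Λ_k ∩ Λ′_k`
(the part of `Q*aQ` inside `Ω = Ω_k ∩ Ω′_k`, identical for the two families). [cite: Balaban1985BackgroundPropagators, p.426 («Ω = Ω_k ∩ Ω′_k»); Balaban1984PropagatorsII, (2.3) p.224, (2.20) p.226] -/
def IsCT (p : (j : Fin (k + 1)) × PBond (PV d ℓ m K hd hL) (j : ℕ)) : Prop :=
  (p.1 : ℕ) = k ∧ (domT hN D hk).LamBond (p.1 : ℕ) p.2 ∧ (domT hN D' hk).LamBond (p.1 : ℕ) p.2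

/-- decidability of `IsCT`. [cite: Balaban1984PropagatorsII, (2.3) p.224, bookkeeping] -/
instance instDecidableIsCT (p : (j : Fin (k + 1)) × PBond (PV d ℓ m K hd hL) (j : ℕ)) : Decidable (IsCT hN D D' hk p) :=
  inferInstanceAs (Decidable (_ ∧ _ ∧ _))

/-- the weight `q_i(f) = Q_j(c, f) ≥ 0` of the fine bond `f` in the average `(Q·)_i`, `i = (j, c)` (a function of the PAIR `(j, c)` only).
[cite: Balaban1984PropagatorsI, (1.18) p.20; Balaban1984PropagatorsII, (2.20) p.226] -/
def qk (p : (j : Fin (k + 1)) × PBond (PV d ℓ m K hd hL) (j : ℕ)) (f : PBond (PV d ℓ m K hd hL) 0) : ℝ :=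
  bondAvgIter (P := PV d ℓ m K hd hL) (p.1 : ℕ) (Pi.single f (1 : ℝ)) p.2

omit hN D D' hk in
/-- `q_i(f) ≥ 0`. [cite: Balaban1984PropagatorsI, (1.18) p.20] -/
theorem qk_nonneg (p : (j : Fin (k + 1)) × PBond (PV d ℓ m K hd hL) (j : ℕ)) (f : PBond (PV d ℓ m K hd hL) 0) : 0 ≤ qk (k := k) p f :=
  bondAvgIter_single_nonneg _ f _

include hk in
/-- **COLUMN MASS**: `q_i(f) ≤ (L^{d+1})^{−j}` (every term of r05's column sum `Σ_c Q_j(c, f) = (L^{d+1})^{−j}` is non-negative).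
[cite: Balaban1984PropagatorsI, (1.11) p.19, (1.18) p.20] -/
theorem qk_le (p : (j : Fin (k + 1)) × PBond (PV d ℓ m K hd hL) (j : ℕ)) (f : PBond (PV d ℓ m K hd hL) 0) :
    qk (k := k) p f ≤ (((((ℓ : ℝ) + 1)) ^ (d + 1))⁻¹) ^ (p.1 : ℕ) := by
  classical
  have hj : (p.1 : ℕ) ≤ (PV d ℓ m K hd hL).m + (PV d ℓ m K hd hL).K := le_trans (Nat.lt_succ_iff.1 p.1.isLt) hk
  have h := sum_bondAvgIter_single (P := PV d ℓ m K hd hL) hj f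
  have hle : bondAvgIter (P := PV d ℓ m K hd hL) (p.1 : ℕ) (Pi.single f (1 : ℝ)) p.2
      ≤ ∑ c : PBond (PV d ℓ m K hd hL) (p.1 : ℕ), bondAvgIter (p.1 : ℕ) (Pi.single f (1 : ℝ)) c :=
    Finset.single_le_sum (fun c _ => bondAvgIter_single_nonneg _ f c) (Finset.mem_univ _)
  rw [h] at hle
  have eL : ((PV d ℓ m K hd hL).L : ℝ) = (ℓ : ℝ) + 1 := by
    show (((ℓ + 1 : ℕ) : ℝ)) = (ℓ : ℝ) + 1
    push_cast; ring
  have ed : (PV d ℓ m K hd hL).d = d + 1 := rfl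
  rw [eL, ed] at hle
  exact hle

omit hN D D' hk in
/-- **`(Qh)_i` IS THE `q_i`-AVERAGE OF `h`**: `(Qh)_i = Σ_f q_i(f)·h(f)` (linearity of the iterated average).
[cite: Balaban1984PropagatorsI, (1.18) p.20; Balaban1984PropagatorsII, (2.20) p.226] -/
theorem bondAvgIter_eq_sum_qk (p : (j : Fin (k + 1)) × PBond (PV d ℓ m K hd hL) (j : ℕ)) (h : PBond (PV d ℓ m K hd hL) 0 → ℝ) :
    bondAvgIter (P := PV d ℓ m K hd hL) (p.1 : ℕ) h p.2 = ∑ f, qk (k := k) p f * h f := by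
  classical
  have hdec : h = ∑ f : PBond (PV d ℓ m K hd hL) 0, h f • (Pi.single f (1 : ℝ) : PBond (PV d ℓ m K hd hL) 0 → ℝ) := by
    funext b
    rw [Finset.sum_apply]
    simp only [Pi.smul_apply, smul_eq_mul]
    rw [Finset.sum_eq_single b]
    · simp
    · intro f _ hf; rw [Pi.single_eq_of_ne (Ne.symm hf), mul_zero]
    · intro hb; exact absurd (Finset.mem_univ _) hb
  conv_lhs => rw [hdec]
  rw [show bondAvgIter (P := PV d ℓ m K hd hL) (p.1 : ℕ) (∑ f, h f • (Pi.single f (1 : ℝ) : PBond (PV d ℓ m K hd hL) 0 → ℝ)) p.2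
      = (B6SectAOntoV1.bondAvgIterLin (PV d ℓ m K hd hL) ℝ (p.1 : ℕ) (∑ f, h f • (Pi.single f (1 : ℝ)))) p.2 from rfl,
    map_sum, Finset.sum_apply]
  refine Finset.sum_congr rfl fun f _ => ?_
  rw [map_smul, Pi.smul_apply, smul_eq_mul, mul_comm]
  rfl

omit hN D D' hk in
/-- **ROW MASS**: `Σ_f q_i(f) = 1` (an average of the constant `1` is `1`). [cite: Balaban1984PropagatorsI, (1.18) p.20] -/
theorem sum_qk (p : (j : Fin (k + 1)) × PBond (PV d ℓ m K hd hL) (j : ℕ)) : ∑ f, qk (k := k) p f = 1 := by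
  have h := bondAvgIter_eq_sum_qk (k := k) p (fun _ => (1 : ℝ))
  simp only [mul_one] at h
  rw [← h]
  have := B5Positivity172Lattice.bondAvgIter_dirConst (P := PV d ℓ m K hd hL) (fun _ : Fin (d + 1) => (1 : ℝ)) (p.1 : ℕ)
  have e1 : (B5Positivity172Lattice.dirConst (fun _ : Fin (d + 1) => (1 : ℝ)) : VecField (PV d ℓ m K hd hL) 0 ℝ)
      = fun _ => 1 := rfl
  rw [e1] at this
  rw [this]
  rfl

omit hN D D' hk in
/-- **`|(Qh)_i| ≤ Σ_f q_i(f)|h(f)|`**. [cite: Balaban1984PropagatorsI, (1.18) p.20] -/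
theorem abs_bondAvgIter_le_sum_qk (p : (j : Fin (k + 1)) × PBond (PV d ℓ m K hd hL) (j : ℕ)) (h : PBond (PV d ℓ m K hd hL) 0 → ℝ) :
    |bondAvgIter (P := PV d ℓ m K hd hL) (p.1 : ℕ) h p.2| ≤ ∑ f, qk (k := k) p f * |h f| := by
  rw [bondAvgIter_eq_sum_qk (k := k)]
  refine (Finset.abs_sum_le_sum_abs _ _).trans (Finset.sum_le_sum fun f _ => ?_)
  rw [abs_mul, abs_of_nonneg (qk_nonneg (k := k) p f)]

/-- **THE TRUNCATED WEIGHTED AVERAGES**: `v_i := [i not a common top index]·w_i·(Qh)_i` on the index bonds of the family `{Ω_j}`.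
[cite: Balaban1984PropagatorsII, (2.16) p.225, (2.20) p.226; Balaban1985BackgroundPropagators, p.427 («all terms … contained in Ω are cancelled»)] -/
def trunc (w : BondIdx (domT hN D hk) → ℝ) (h : PBond (PV d ℓ m K hd hL) 0 → ℝ) : BondIdxSpace (domT hN D hk) :=
  WithLp.toLp 2 fun i => if IsCT hN D D' hk i.1 then 0 else w i * bondAvgIter (P := PV d ℓ m K hd hL) (i.1.1 : ℕ) h i.1.2

/-- the same for the family `{Ω′_j}`. [cite: Balaban1984PropagatorsII, (2.16) p.225, (2.20) p.226; Balaban1985BackgroundPropagators, p.427] -/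
def trunc' (w' : BondIdx (domT hN D' hk) → ℝ) (h : PBond (PV d ℓ m K hd hL) 0 → ℝ) : BondIdxSpace (domT hN D' hk) :=
  WithLp.toLp 2 fun i => if IsCT hN D D' hk i.1 then 0 else w' i * bondAvgIter (P := PV d ℓ m K hd hL) (i.1.1 : ℕ) h i.1.2

/-- evaluation of `trunc`. [cite: Balaban1984PropagatorsII, (2.20) p.226, bookkeeping] -/
@[simp] theorem trunc_apply (w : BondIdx (domT hN D hk) → ℝ) (h : PBond (PV d ℓ m K hd hL) 0 → ℝ) (i : BondIdx (domT hN D hk)) :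
    trunc hN D D' hk w h i = if IsCT hN D D' hk i.1 then 0 else w i * bondAvgIter (P := PV d ℓ m K hd hL) (i.1.1 : ℕ) h i.1.2 := rfl

/-- evaluation of `trunc'`. [cite: Balaban1984PropagatorsII, (2.20) p.226, bookkeeping] -/
@[simp] theorem trunc'_apply (w' : BondIdx (domT hN D' hk) → ℝ) (h : PBond (PV d ℓ m K hd hL) 0 → ℝ) (i : BondIdx (domT hN D' hk)) :
    trunc' hN D D' hk w' h i = if IsCT hN D D' hk i.1 then 0 else w' i * bondAvgIter (P := PV d ℓ m K hd hL) (i.1.1 : ℕ) h i.1.2 := rfl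

/-- `Q*aQh` at a fine bond: `(Q*a(Qh))(f) = Σ_i w_i (Qh)_i q_i(f)`. [cite: Balaban1984PropagatorsII, (2.18)–(2.20) p.226] -/
theorem onFun_QaQ_apply {P₀ : Params} (Dm : B6SectADomainsV1.Domains P₀) (w : BondIdx Dm → ℝ) (h : PBond P₀ 0 → ℝ) (f : PBond P₀ 0) :
    onFun (QsE Dm ∘ₗ aE Dm w ∘ₗ QE Dm) h f = ∑ i : BondIdx Dm, w i * bondAvgIter (i.1.1 : ℕ) h i.1.2 * bondAvgIter (i.1.1 : ℕ) (Pi.single f (1 : ℝ)) i.1.2 := by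
  rw [onFun_apply, LinearMap.comp_apply, LinearMap.comp_apply, QsE_apply_eq_sum]
  rfl

/-- **THE COMMON TOP PART OF `Q*aQ` IS THE SAME FOR THE TWO FAMILIES** (equal weights on the common top index bonds):
`Σ_{i ∈ 𝔅, common top} w_i(Qh)_iq_i(f) = Σ_{i′ ∈ 𝔅′, common top} w′_{i′}(Qh)_{i′}q_{i′}(f)`.
[cite: Balaban1985BackgroundPropagators, p.427 («in the difference all terms for walks with localizations contained in Ω are cancelled»)] -/
theorem sum_CT_eq {w : BondIdx (domT hN D hk) → ℝ} {w' : BondIdx (domT hN D' hk) → ℝ}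
    (hww : ∀ (i : BondIdx (domT hN D hk)) (i' : BondIdx (domT hN D' hk)), i.1 = i'.1 → w i = w' i')
    (F : ((j : Fin (k + 1)) × PBond (PV d ℓ m K hd hL) (j : ℕ)) → ℝ) :
    ∑ i : BondIdx (domT hN D hk), (if IsCT hN D D' hk i.1 then w i * F i.1 else 0)
      = ∑ i' : BondIdx (domT hN D' hk), (if IsCT hN D D' hk i'.1 then w' i' * F i'.1 else 0) := by
  classical
  -- both sides are sums over the common top pairs
  rw [← Finset.sum_filter, ← Finset.sum_filter]
  refine Finset.sum_bij (fun i hi => (⟨i.1, ((Finset.mem_filter.1 hi).2).2.2⟩ : BondIdx (domT hN D' hk))) ?_ ?_ ?_ ?_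
  · intro i hi
    exact Finset.mem_filter.2 ⟨Finset.mem_univ _, (Finset.mem_filter.1 hi).2⟩
  · intro i hi i₂ hi₂ h
    exact Subtype.ext (congrArg (fun z : BondIdx (domT hN D' hk) => z.1) h)
  · intro i' hi'
    have hct := (Finset.mem_filter.1 hi').2
    exact ⟨⟨i'.1, hct.2.1⟩, Finset.mem_filter.2 ⟨Finset.mem_univ _, hct⟩, rfl⟩
  · intro i hi
    rw [hww i ⟨i.1, _⟩ rfl]

/-- **THE `Q*aQ` LETTER AFTER THE CANCELLATION**: `(V_Qh)(f) = (Q′*v′)(f) − (Q*v)(f)` with the TRUNCATED weighted averages `v, v′` — only the index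
bonds which are not common top index bonds survive. [cite: Balaban1985BackgroundPropagators, Thm 3.14 p.427; Balaban1984PropagatorsII, (2.20) p.226] -/
theorem VQ_apply_eq {w : BondIdx (domT hN D hk) → ℝ} {w' : BondIdx (domT hN D' hk) → ℝ}
    (hww : ∀ (i : BondIdx (domT hN D hk)) (i' : BondIdx (domT hN D' hk)), i.1 = i'.1 → w i = w' i')
    (h : PBond (PV d ℓ m K hd hL) 0 → ℝ) (f : PBond (PV d ℓ m K hd hL) 0) :
    VQ hN D D' hk w w' h f = QsE (domT hN D' hk) (trunc' hN D D' hk w' h) f - QsE (domT hN D hk) (trunc hN D D' hk w h) f := by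
  classical
  unfold VQ
  rw [LinearMap.sub_apply, Pi.sub_apply, onFun_QaQ_apply, onFun_QaQ_apply, QsE_apply_eq_sum, QsE_apply_eq_sum]
  simp only [trunc_apply, trunc'_apply, ite_mul, zero_mul]
  -- split each full sum into its common-top part and the rest
  have hsplit : ∀ {ι : Type} [Fintype ι] (c : ι → Prop) [DecidablePred c] (a : ι → ℝ),
      ∑ i, a i = (∑ i, if c i then a i else 0) + ∑ i, if c i then 0 else a i := by
    intro ι _ c _ a
    rw [← Finset.sum_add_distrib]
    refine Finset.sum_congr rfl fun i _ => ?_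
    split_ifs <;> simp
  rw [hsplit (fun i : BondIdx (domT hN D' hk) => IsCT hN D D' hk i.1), hsplit (fun i : BondIdx (domT hN D hk) => IsCT hN D D' hk i.1)]
  have hct := sum_CT_eq hN D D' hk hww
    (fun p => bondAvgIter (P := PV d ℓ m K hd hL) (p.1 : ℕ) h p.2 * bondAvgIter (P := PV d ℓ m K hd hL) (p.1 : ℕ) (Pi.single f (1 : ℝ)) p.2)
  simp only [← mul_assoc] at hct
  rw [hct]
  ring

/-- **A SURVIVING INDEX BOND OF `{Ω_j}` CHARGES ONLY FINE BONDS IN `Ωᶜ`**: if `i = (j, c) ∈ 𝔅` is not a common top index bond and `q_i(f) ≠ 0`,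
then the `k`-lattice point of `f₋` lies in `Ωᶜ ∩ T^{(k)}` — for `j < k` the level of `f₋` is `≤ j < k`; for `j = k`, `c ∉ Λ′_k = st(Ω′_k)` puts the
`k`-block of `f₋` (`= c₋` or `c₊`) outside `Ω′_k`. [cite: Balaban1985BackgroundPropagators, Thm 3.14 p.427 («at least one localization … intersects Ωᶜ»); Balaban1984PropagatorsII, (2.3) p.224] -/
theorem witness_of_not_isCT (hk1 : 1 ≤ k) (i : BondIdx (domT hN D hk)) (hi : ¬ IsCT hN D D' hk i.1) (f : PBond (PV d ℓ m K hd hL) 0)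
    (hq : bondAvgIter (P := PV d ℓ m K hd hL) (i.1.1 : ℕ) (Pi.single f (1 : ℝ)) i.1.2 ≠ 0) :
    blk ((ℓ + 1) ^ k) (toBox hN f.src).1 ∈ OmegaC D D' := by
  refine blk_mem_OmegaC D D' ?_
  rintro ⟨hD, hD'⟩
  have hjk : (i.1.1 : ℕ) ≤ k := Nat.lt_succ_iff.1 i.1.1.isLt
  have hcov := lev_le_of_bondAvgIter_single_ne_zero hN D hk i f hq
  rcases lt_or_eq_of_le hjk with hlt | heq
  · omega
  · apply hi
    refine ⟨heq, i.2, ?_⟩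
    -- `j = k`: both end-points of `c` outside `Ω′_k` would put `f₋` below level `k` in the second family
    have hnd : ∀ y, ¬ (domT hN D' hk).Deep (i.1.1 : ℕ) y := fun y =>
      B6SectADomainsV1.Domains.not_deep_of_le _ (by show k ≤ (i.1.1 : ℕ); omega) y
    refine ⟨?_, hnd _, hnd _⟩
    by_contra hout
    rw [not_or] at hout
    have hloc := iterBlockOf_of_bondAvgIter_single_ne_zero (P := PV d ℓ m K hd hL)
      (show (i.1.1 : ℕ) ≤ (PV d ℓ m K hd hL).m + (PV d ℓ m K hd hL).K from le_trans hjk hk) hq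
    have hnot : iterBlockOf (i.1.1 : ℕ) f.src ∉ (domT hN D' hk).Om (i.1.1 : ℕ) := by
      rcases hloc with h | h <;> rw [h]
      · exact hout.1
      · exact hout.2
    rw [iterBlockOf_mem_domT_iff hN D' hk (by omega) hjk] at hnot
    omega

/-- … and the same for a surviving index bond of `{Ω′_j}`. [cite: Balaban1985BackgroundPropagators, Thm 3.14 p.427; Balaban1984PropagatorsII, (2.3) p.224] -/
theorem witness_of_not_isCT' (hk1 : 1 ≤ k) (i' : BondIdx (domT hN D' hk)) (hi : ¬ IsCT hN D D' hk i'.1) (f : PBond (PV d ℓ m K hd hL) 0)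
    (hq : bondAvgIter (P := PV d ℓ m K hd hL) (i'.1.1 : ℕ) (Pi.single f (1 : ℝ)) i'.1.2 ≠ 0) :
    blk ((ℓ + 1) ^ k) (toBox hN f.src).1 ∈ OmegaC D D' := by
  refine blk_mem_OmegaC D D' ?_
  rintro ⟨hD, hD'⟩
  have hjk : (i'.1.1 : ℕ) ≤ k := Nat.lt_succ_iff.1 i'.1.1.isLt
  have hcov := lev_le_of_bondAvgIter_single_ne_zero hN D' hk i' f hq
  rcases lt_or_eq_of_le hjk with hlt | heq
  · omega
  · apply hi
    refine ⟨heq, ?_, i'.2⟩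
    have hnd : ∀ y, ¬ (domT hN D hk).Deep (i'.1.1 : ℕ) y := fun y =>
      B6SectADomainsV1.Domains.not_deep_of_le _ (by show k ≤ (i'.1.1 : ℕ); omega) y
    refine ⟨?_, hnd _, hnd _⟩
    by_contra hout
    rw [not_or] at hout
    have hloc := iterBlockOf_of_bondAvgIter_single_ne_zero (P := PV d ℓ m K hd hL)
      (show (i'.1.1 : ℕ) ≤ (PV d ℓ m K hd hL).m + (PV d ℓ m K hd hL).K from le_trans hjk hk) hq
    have hnot : iterBlockOf (i'.1.1 : ℕ) f.src ∉ (domT hN D hk).Om (i'.1.1 : ℕ) := by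
      rcases hloc with h | h <;> rw [h]
      · exact hout.1
      · exact hout.2
    rw [iterBlockOf_mem_domT_iff hN D hk (by omega) hjk] at hnot
    omega

/-- **THE WEIGHT BAND IN THE FORM USED**: `0 ≤ w_i ≤ b₁·c_f²·(L^j)^{d+1}·(L^j)⁻²` on an index bond of level `j`.
[cite: Balaban1984PropagatorsII, (2.16) p.225] -/
theorem w_le_of_band {b₀ b₁ cf : ℝ} (hcf : cf ≠ 0) {w : BondIdx (domT hN D hk) → ℝ} (hwb : GlobalBand b₀ b₁ cf w)
    (i : BondIdx (domT hN D hk)) :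
    w i ≤ b₁ * cf ^ 2 * ((((ℓ : ℝ) + 1) ^ (i.1.1 : ℕ)) ^ (d + 1)) * (((((ℓ : ℝ) + 1) ^ (i.1.1 : ℕ)) ^ 2))⁻¹ := by
  have h := (hwb i).2
  have hL : (0 : ℝ) < ((ℓ + 1 : ℕ) : ℝ) ^ (i.1.1 : ℕ) := by positivity
  have hq : 0 < (cf / (((ℓ + 1 : ℕ) : ℝ) ^ (i.1.1 : ℕ))) ^ 2 := by positivity
  rw [div_le_iff₀ hq] at h
  refine h.trans (le_of_eq ?_)
  have e : (((ℓ + 1 : ℕ) : ℝ)) = (ℓ : ℝ) + 1 := by push_cast; ring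
  rw [e]
  field_simp

end QLetter

end Literature.MathematicalPhysics.QuantumFieldTheory.Balaban1983to89.B9Thm314GFlatV1Kernel

end
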